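import Summits.ResolutionOfSingularities.ResolutionOfSingularities.Theses.RadicialJung
import Summits.ResolutionOfSingularities.ResolutionOfSingularities.Theorems.DescentDescentPerfectToAllOfCleanModelsDimGEFour
import Literature.AlgebraicGeometry.Resolution.Principalization
import Literature.AlgebraicGeometry.Resolution.BadCurveInduction
import Literature.AlgebraicGeometry.Resolution.ZariskiPatchingAllDimensions
import HarnessLib

/-!
# STUB PLAN (typed candidate) for the research residue T4 of `stub_cleanPatching3` — `CleanPrincipalization₃`

res-B-lens-5 g2 (planner; lens 5 «transfer from the solved sibling»), 2026-08-28.  Companion of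
`Cruxes/DescentPerfectToAll/STUBPLAN-cleanPatching3-piltant-lens5.md` §4 (TREE ROUTE).  bears_on: LADDER-RESOLUTION:B (dim-3 slice, off
rung B's price) · [OURS · CANDIDATE] counted 0; nothing here proves resolution in char p; STATEMENTS ONLY (no theorem is claimed), for
the 15917 lead (res-B-lead-1 g1) to adopt, rename or discard.

The sibling's globalization theorem (Piltant 2013, RACSAM 107, Thm. 2.4 / Prop. 5.1 / Cor. 5.7) is PROVED in the tree for `P = P_reg`
modulo the named fact `CossartPiltant2019Principalization` (`Principalization.lean`; consumers `ProjModel.exists_step`,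
`ProjModel.exists_regLe_pair_over`, `ProjModel.twoModelPatching_of_principalization`, `CossartPiltant2019Patching.of_principalization`,
`CossartPiltant2019Patching.of_twoModelPatching'`, `hasResolution_of_twoModelPatching_of_uniformizable`).  For `P = P_clean(g₀)`
(«regular ∧ the `K^p`-line of `g₀` loosely clean at the stalk») the one input of that proof with NO printed or tree analogue is
Piltant's Axiom 4 (principalization over `Reg_P` KEEPING `P`), i.e. Cossart–Piltant 2019 Prop. 4.4 run on an everywhere-clean regular
excellent threefold so that the line stays loosely clean at every point upstairs.  `CleanPrincipalization₃` below types exactly that, in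
the vocabulary of `CossartPiltant2019Principalization` (`IsRegularCentreBlowupSeq`, `IsLocallyPrincipal`) and of the slot's hard stub
`CleanModelsDimGEFour` / the lead's `LogCleanPrincipalization₃` (stalk-level three-form disjunction, `RatFn.functionFieldMap`).
HOW one would prove it (not typed): choose the centres of Prop. 4.4's procedure with normal crossings to the total clean divisor
`B` = {prime divisors along which the line has a representative of order prime to `p`} (a well-defined reduced SNC divisor on the clean
locus) — then cleanness is preserved above every centre by the closed-point computation of res-B-lens-1 g2 ADDENDUM A §3.1 (pole-free
derivation + `K^p`-twist, `nonTrivRep_twist` p660208) run along SNC-permissible centres (T2 of the STUBPLAN).  Size L–XL.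
[cite: Piltant2013, Axiom 4 and Prop. 4.2] [cite: CossartPiltant2019, Prop. 4.4]
-/

noncomputable section

set_option linter.dupNamespace false

open CategoryTheory AlgebraicGeometry
open Literature.AlgebraicGeometry.Resolution Literature.AlgebraicGeometry.Motives

namespace Summit.ResolutionOfSingularities.ResolutionOfSingularities.Cruxes.DescentPerfectToAll.ViaCpFrame.StubPlan

/-- The three LOOSELY CLEAN FORMS of a rational function `G ∈ K(X)` at the stalk of `x ∈ X` (verbatim the disjunction inside the slot's
hard stub `CleanModelsDimGEFour` / the lead's `LogCleanPrincipalization₃`): (1) `G` = a monomial with exponents prime to `p` in part of a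
regular system of parameters (`0 < m ≤ d = dim 𝒪_{X,x}`); (2) `G` = a unit `u₀` with `u₀ − c^p ∉ 𝔪` for every `c`; (3) `G` = a unit `u₀`
with `u₀ − c^p ∈ 𝔪 ∖ 𝔪²` for some `c` (form (3) is form (1) with `m = 1`, `a = 1` for the representative `G − c^p`; kept for
byte-compatibility with the slot). [cite: CossartPiltant2019, Def. 2.4 (E ⊆ div(u₁⋯u_e)) and Prop. 2.22] -/
def LooseForms (X : Scheme.{0}) [IsIntegral X] (p : ℕ) (x : X) (G : X.functionField) : Prop :=
  (∃ (d m : ℕ) (hmd : m ≤ d) (t : Fin d → X.presheaf.stalk x) (a : Fin m → ℕ),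
      Ideal.span (Set.range t) = IsLocalRing.maximalIdeal (X.presheaf.stalk x) ∧
      ringKrullDim (X.presheaf.stalk x) = (d : WithBot ℕ∞) ∧ 0 < m ∧ (∀ i, ¬ p ∣ a i) ∧
      G = ∏ i : Fin m, (algebraMap (X.presheaf.stalk x) X.functionField (t (Fin.castLE hmd i))) ^ (a i)) ∨
  (∃ u₀ : X.presheaf.stalk x, IsUnit u₀ ∧ G = algebraMap (X.presheaf.stalk x) X.functionField u₀ ∧
      ((∀ c : X.presheaf.stalk x, u₀ - c ^ p ∉ IsLocalRing.maximalIdeal (X.presheaf.stalk x)) ∨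
       (∃ c : X.presheaf.stalk x, u₀ - c ^ p ∈ IsLocalRing.maximalIdeal (X.presheaf.stalk x) ∧
          u₀ - c ^ p ∉ IsLocalRing.maximalIdeal (X.presheaf.stalk x) ^ 2)))

/-- The `K(S)^p`-line of the degree-`p` radicial extension `K(S) → L` (the non-trivial representatives are the `g ∈ K(S)` with a
`p`-th root in `L ∖ K(S)`) is LOOSELY CLEAN AT `s ∈ S`: some non-trivial representative has a loose form at the stalk of `s`.
[cite: CossartPiltant2019, Prop. 2.22] -/
def LineCleanAt (S : Scheme.{0}) [IsIntegral S] (L : Type) [Field L] [Algebra S.functionField L] (p : ℕ) (s : S) : Prop :=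
  ∃ (y : L) (g : S.functionField), y ∉ Set.range (algebraMap S.functionField L) ∧
    algebraMap S.functionField L g = y ^ p ∧ LooseForms S p s g

/-- … and loosely clean at `x ∈ X` ALONG a dominant `π : X → S` (the representative `g ∈ K(S)` is read in `K(X)` through `π^♯`),
the shape used pointwise on `V` by `CleanModelsDimGEFour`. [cite: CossartPiltant2019, Prop. 2.22] -/
def LineCleanAlong (S : Scheme.{0}) [IsIntegral S] (L : Type) [Field L] [Algebra S.functionField L] (p : ℕ)
    (X : Scheme.{0}) [IsIntegral X] (π : X ⟶ S) [IsDominant π] (x : X) : Prop :=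
  ∃ (y : L) (g : S.functionField), y ∉ Set.range (algebraMap S.functionField L) ∧
    algebraMap S.functionField L g = y ^ p ∧ LooseForms X p x (RatFn.functionFieldMap π g)

/-- **T4 `CleanPrincipalization₃` — Piltant's Axiom 4 for `P = P_clean`, alias Cossart–Piltant 2019 Prop. 4.4 KEEPING CLEANNESS**
(the research residue of `stub_cleanPatching3`; OPEN, no print): on a regular, Noetherian, integral, excellent scheme `S` of dimension
three whose function field has characteristic `p`, for a degree-`p` purely inseparable `K(S) → L` whose `K(S)^p`-line is loosely clean at
EVERY point of `S`, every nonzero ideal sheaf `J` is principalized by a finite composition `σ : S' → S` of blowing ups along regular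
integral centres lying in the non-locally-principal loci of the transforms of `J` (the conclusion of `CossartPiltant2019Principalization`,
verbatim) such that, IN ADDITION, the line is loosely clean at every point of `S'` along `σ`.  Dropping the last clause gives an instance of
`CossartPiltant2019Principalization`; the clause is what Zariski's bad-curve induction (`ProjModel.exists_step`,
`ProjModel.exists_regLe_pair_over` with `RegLe ↦ CleanRegLe`) consumes. [cite: Piltant2013, Axiom 4 (i)(ii)(iii) and Prop. 4.2]
[cite: CossartPiltant2019, Prop. 4.4 (arXiv v1: Prop. 4.3)] -/
def CleanPrincipalization₃ : Prop :=
  ∀ p : ℕ, p.Prime → ∀ (S : Scheme.{0}) [IsIntegral S] [IsNoetherian S] (L : Type) [Field L] [Algebra S.functionField L],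
    CharP S.functionField p → IsPurelyInseparable S.functionField L → Module.finrank S.functionField L = p →
    Scheme.IsRegular S → Scheme.IsExcellent S → topologicalKrullDim S = 3 →
    (∀ s : S, LineCleanAt S L p s) →
    ∀ J : S.IdealSheafData, J ≠ ⊥ →
      ∃ (S' : Scheme.{0}) (σ : S' ⟶ S) (_ : IsIntegral S') (_ : IsDominant σ),
        IsRegularCentreBlowupSeq σ J ∧ IsLocallyPrincipal (J.comap σ) ∧ ∀ s' : S', LineCleanAlong S L p S' σ s'

/-- **T2 `CleanPointBlowup` — Piltant's Axiom 2 (ii) at CLOSED points for `P = P_clean`, every dimension** (res-B-lens-1 g2 ADDENDUM A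
§3.1: «cleanness survives closed-point blow-ups in every dimension», proof sketch by a pole-free derivation and a `K^p`-twist; size M):
blowing up a regular, Noetherian, integral, excellent scheme `S` (any dimension, characteristic `p` function field) at a closed point at
which the line is loosely clean yields `S'` on which the line is loosely clean at every point above that point.  Typed with the blow-up
as `IsBlowup τ (vanishingIdeal {s})` exactly as in `IsRegularCentreBlowupSeq.cons`. [cite: Piltant2013, Axiom 2 (ii)]
[cite: CossartPiltant2019, Prop. 2.22] -/
def CleanPointBlowup : Prop :=
  ∀ p : ℕ, p.Prime → ∀ (S : Scheme.{0}) [IsIntegral S] [IsNoetherian S] (L : Type) [Field L] [Algebra S.functionField L],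
    CharP S.functionField p → IsPurelyInseparable S.functionField L → Module.finrank S.functionField L = p →
    Scheme.IsRegular S → Scheme.IsExcellent S →
    ∀ (s : S) (hs : IsClosed ({s} : Set S)), LineCleanAt S L p s →
    ∀ (S' : Scheme.{0}) (τ : S' ⟶ S) [IsIntegral S'] [IsDominant τ],
      IsBlowup τ (Scheme.IdealSheafData.vanishingIdeal ⟨{s}, hs⟩) →
      ∀ s' : S', τ.base s' = s → LineCleanAlong S L p S' τ s'

end Summit.ResolutionOfSingularities.ResolutionOfSingularities.Cruxes.DescentPerfectToAll.ViaCpFrame.StubPlan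

end
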